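import Literature.NumberTheory.Sieve.MatomakiRadziwillLemma4Lipschitz
import Literature.NumberTheory.LFunctions.PretentiousDistanceFord
import Mathlib.Algebra.BigOperators.Module
import HarnessLib

/-!
# Matomäki–Radziwiłł 2016, Lemma 3 — the Halász step (Lemma 1 form) and the sifted twist

Topic `Literature/NumberTheory/Sieve`.  Everything in this file is PROVED (the only named input is passed as
a hypothesis: `GranvilleSoundararajan2003_theorem1`, the sharp Halász theorem).  This is the first half
of a discharge of `MatomakiRadziwill2016_lemma3` (`MatomakiRadziwillProp1Inputs.lean`; Ann. of Math.
183 (2016), §2 Lemma 3: the bound for `R(1+it) = ∑_{X ≤ n ≤ 2X} f(n) n^{-1-it}/(#{p ∈ [P,Q] : p ∣ n} + 1)`),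
whose printed proof reads: "Splitting `n = n₁n₂` where `n₁` has all prime factors from `[P, Q]` and `n₂`
has none … To the first term we apply Halász's theorem (Lemmas 1 and 2) to the sum over `n₂`".

* `MatomakiRadziwillL3.halasz_of_GS` — **Lemma 1 of MR from GS03 Theorem 1**:
  `|∑_{n ≤ x} g(n)| ≤ x (C e^{-(39/40) M₀} + C (1/T + log log x/log x))` whenever
  `M₀ ≤ 𝔻(g, n^{iy}; x)²` for `|y| ≤ 2T` (the loss `39/40` absorbs GS's `L log(e^γ/L)`; it needs the `1/T`
  of Granville–Soundararajan, the `1/√T` of the Halász–Montgomery–Tenenbaum form being too weak for the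
  printed exponent `1/16` of Lemma 3).
* `MatomakiRadziwillL3.norm_sum_div_le_of_partial`, `norm_sum_Icc_div_le` — partial summation to
  `∑_{a ≤ n ≤ b} g(n)/n` ("and partial summation" in MR's Lemma 1).
* `MatomakiRadziwillL3.sieveInd`, `siftedTwist f S t = (f · 1_{(n, ∏_{p ∈ S} p) = 1}) n^{-it}` — the
  multiplicative `1`-bounded function to which Halász is applied, and
  `MatomakiRadziwillL3.Msum_siftedTwist_ge` — its distance:
  `𝔻(G, n^{iu}; y)² ≥ ¼ 𝔻(1, n^{2i(t+u)}; y)² + ½ ∑_{p ≤ y, p ∈ S} 1/p`; the first term is bounded below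
  by `PretentiousFord.pretentiousDistSq_one_twist_ge` (MR Lemma 2), the second is the sifting gain
  `≈ ½ log(log Q/log P)` that offsets the sum over `n₁` in Lemma 3.

## References
* K. Matomäki, M. Radziwiłł, Ann. of Math. (2) 183 (2016) (arXiv:1501.04585), §2 Lemmas 1–3.
  [cite: MatomakiRadziwillAnnals2016, Lemmas 1, 3]
* A. Granville, K. Soundararajan, *Decay of mean values of multiplicative functions*, Canad. J. Math. 55
  (2003), Theorem 1. [cite: GranvilleSoundararajan2003, Theorem 1]
-/

noncomputable section

open Finset Real Complex
open Literature.NumberTheory.LFunctions.GranvilleSoundararajan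
open Literature.NumberTheory.Sieve.MatomakiRadziwillL4A

namespace Literature.NumberTheory.Sieve

namespace MatomakiRadziwillL3

/-! ### Halász's theorem in the form of MR's Lemma 1, from Granville–Soundararajan's Theorem 1 -/

/-- **Halász (GS03 Theorem 1) with a lower bound for the distance**: there is `C` such that for every
multiplicative `g` with `|g| ≤ 1`, `x ≥ 3`, `T ≥ 1` and every `M₀` with `M₀ ≤ 𝔻(g, n^{iy}; x)²` for all
`|y| ≤ 2T`, `|∑_{n ≤ x} g(n)| ≤ x (C e^{-(39/40) M₀} + C (1/T + log log x / log x))`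
(`L = max|F|/log x ≤ e⁷ e^{-M₀}` by `norm_truncEulerProduct_le`, then `L log(e^γ/L) + 12L/7 ≤ 43 L^{39/40}`).
[cite: GranvilleSoundararajan2003, Theorem 1] [cite: MatomakiRadziwillAnnals2016, Lemma 1] -/
theorem halasz_of_GS (hGS : GranvilleSoundararajan2003_theorem1) :
    ∃ C : ℝ, 0 ≤ C ∧ ∀ g : ArithmeticFunction ℂ, g.IsMultiplicative → (∀ n, ‖g n‖ ≤ 1) →
      ∀ x T M₀ : ℝ, 3 ≤ x → 1 ≤ T → (∀ y : ℝ, |y| ≤ 2 * T → M₀ ≤ Msum g x y) →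
        ‖∑ n ∈ Icc 1 ⌊x⌋₊, g n‖ ≤
          x * (C * Real.exp (-(39 / 40) * M₀) + C * (1 / T + Real.log (Real.log x) / Real.log x)) := by
  obtain ⟨C₁, hC₁⟩ := hGS
  -- the GS constant may be taken nonnegative (test with `g = 1`… simpler: replace by `max C₁ 0`)
  refine ⟨max (43 * Real.exp 7) (max C₁ 0) + Real.exp 7, by positivity, ?_⟩
  intro g hg hg1 x T M₀ hx hT hM
  set C := max (43 * Real.exp 7) (max C₁ 0) + Real.exp 7 with hCdef
  have hx0 : 0 < x := by linarith
  have hlogx : 1 < Real.log x := by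
    rw [← Real.log_exp 1]
    refine Real.log_lt_log (Real.exp_pos 1) (lt_of_lt_of_le ?_ hx)
    have := Real.exp_one_lt_d9; norm_num at this ⊢; linarith
  have hR0 : 0 ≤ 1 / T + Real.log (Real.log x) / Real.log x := by
    have : 0 ≤ Real.log (Real.log x) := Real.log_nonneg hlogx.le
    positivity
  have hS1 : ‖∑ n ∈ Icc 1 ⌊x⌋₊, g n‖ ≤ x := by
    calc ‖∑ n ∈ Icc 1 ⌊x⌋₊, g n‖ ≤ ∑ n ∈ Icc 1 ⌊x⌋₊, ‖g n‖ := norm_sum_le _ _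
      _ ≤ ∑ n ∈ Icc 1 ⌊x⌋₊, (1 : ℝ) := Finset.sum_le_sum fun n _ => hg1 n
      _ = ⌊x⌋₊ := by simp
      _ ≤ x := Nat.floor_le hx0.le
  have hGS' := hC₁ g hg hg1 x T hx hT
  -- `L ≤ e⁷ e^{-M₀}`
  obtain ⟨y₀, hy₀, hmax⟩ := exists_maximiser hg1 x (by linarith : (0 : ℝ) ≤ T)
  obtain ⟨hL0, hLle⟩ := maxModulus_le (g := g) x (by linarith : (0 : ℝ) ≤ T) hmax
  have hF := norm_truncEulerProduct_le hg1 hg.map_one (by linarith : (2 : ℝ) ≤ x) y₀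
  have hMy₀ := hM y₀ hy₀
  set ℓ : ℝ := Real.exp 7 * Real.exp (-M₀) with hℓ
  have hLℓ : maxModulus g x T / Real.log x ≤ ℓ := by
    rw [div_le_iff₀ (by linarith)]
    calc maxModulus g x T ≤ ‖truncEulerProduct g x (1 + y₀ * I)‖ := hLle
      _ ≤ Real.exp 7 * Real.log x * Real.exp (-Msum g x y₀) := hF
      _ ≤ Real.exp 7 * Real.log x * Real.exp (-M₀) := by
          refine mul_le_mul_of_nonneg_left (Real.exp_le_exp.2 (by linarith)) (by positivity)
      _ = ℓ * Real.log x := by rw [hℓ]; ring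
  have hL0' : 0 ≤ maxModulus g x T / Real.log x := div_nonneg hL0 (by linarith)
  -- the exponential factor
  have hexp : Real.exp (-(39 / 40) * M₀) = (Real.exp (-M₀)) ^ (39 / 40 : ℝ) := by
    rw [← Real.exp_mul]; ring_nf
  have hC1 : C₁ ≤ C := by
    rw [hCdef]
    have := le_max_right (43 * Real.exp 7) (max C₁ 0)
    have := le_max_left C₁ 0
    linarith [Real.exp_pos 7]
  have hRterm : C₁ * (1 / T + Real.log (Real.log x) / Real.log x) ≤ C * (1 / T + Real.log (Real.log x) / Real.log x) :=
    mul_le_mul_of_nonneg_right hC1 hR0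
  rcases le_or_gt 1 ℓ with hℓ1 | hℓ1
  · -- `M₀ ≤ 7`: the trivial bound `‖S‖ ≤ x ≤ x · e⁷ e^{-(39/40) M₀}`
    have hM7 : Real.exp (-(39 / 40) * M₀) ≥ Real.exp (-7) := by
      refine Real.exp_le_exp.2 ?_
      -- from `1 ≤ e⁷ e^{-M₀}`: `M₀ ≤ 7`
      have h1 : M₀ ≤ 7 := by
        by_contra h; push Not at h
        have : Real.exp 7 * Real.exp (-M₀) < 1 := by
          rw [← Real.exp_add]; rw [show (1:ℝ) = Real.exp 0 from (Real.exp_zero).symm]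
          exact Real.exp_lt_exp.2 (by linarith)
        linarith
      rcases le_or_gt 0 M₀ with h0 | h0 <;> nlinarith
    have h1 : (1 : ℝ) ≤ C * Real.exp (-(39 / 40) * M₀) := by
      have hC7 : Real.exp 7 ≤ C := by rw [hCdef]; linarith [le_max_left (43 * Real.exp 7) (max C₁ 0), Real.exp_pos 7]
      calc (1 : ℝ) = Real.exp 7 * Real.exp (-7) := by rw [← Real.exp_add]; norm_num
        _ ≤ C * Real.exp (-(39 / 40) * M₀) := mul_le_mul hC7 hM7 (Real.exp_pos _).le (by positivity)
    have hC0 : 0 ≤ C * (1 / T + Real.log (Real.log x) / Real.log x) := mul_nonneg (by positivity) hR0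
    calc ‖∑ n ∈ Icc 1 ⌊x⌋₊, g n‖ ≤ x * 1 := by linarith
      _ ≤ x * (C * Real.exp (-(39 / 40) * M₀) + C * (1 / T + Real.log (Real.log x) / Real.log x)) :=
          mul_le_mul_of_nonneg_left (by linarith) hx0.le
  · -- `ℓ < 1`: GS Theorem 1 with `L ≤ ℓ`
    have hA := thm1_with_bound hGS' hL0' hLℓ hℓ1.le
    have hℓpow : ℓ ^ (39 / 40 : ℝ) = (Real.exp 7) ^ (39 / 40 : ℝ) * Real.exp (-(39 / 40) * M₀) := by
      rw [hℓ, Real.mul_rpow (Real.exp_pos _).le (Real.exp_pos _).le, hexp]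
    have h7 : (Real.exp 7) ^ (39 / 40 : ℝ) ≤ Real.exp 7 :=
      Real.rpow_le_self_of_one_le (by have := Real.add_one_le_exp (7:ℝ); linarith) (by norm_num)
    have hmain : 43 * ℓ ^ (39 / 40 : ℝ) ≤ C * Real.exp (-(39 / 40) * M₀) := by
      rw [hℓpow]
      have hC43 : 43 * Real.exp 7 ≤ C := by
        rw [hCdef]; linarith [le_max_left (43 * Real.exp 7) (max C₁ 0), Real.exp_pos 7]
      calc 43 * ((Real.exp 7) ^ (39 / 40 : ℝ) * Real.exp (-(39 / 40) * M₀))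
          = (43 * (Real.exp 7) ^ (39 / 40 : ℝ)) * Real.exp (-(39 / 40) * M₀) := by ring
        _ ≤ C * Real.exp (-(39 / 40) * M₀) := by
            refine mul_le_mul_of_nonneg_right ?_ (Real.exp_pos _).le
            nlinarith [Real.exp_pos 7]
    have hdiv : ‖∑ n ∈ Icc 1 ⌊x⌋₊, g n‖ / x ≤
        C * Real.exp (-(39 / 40) * M₀) + C * (1 / T + Real.log (Real.log x) / Real.log x) := by
      linarith
    rwa [div_le_iff₀ hx0, mul_comm] at hdiv

/-! ### Partial summation: `∑_{a ≤ n ≤ b} g(n)/n` from the partial sums -/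

/-- **Partial summation**: if `‖∑_{i < k} g(i)‖ ≤ B` for `a ≤ k ≤ b + 1`, then
`‖∑_{a ≤ n ≤ b} g(n)/n‖ ≤ 3B/a` (`a ≥ 1`). [folklore] -/
theorem norm_sum_div_le_of_partial {g : ℕ → ℂ} {a b : ℕ} (ha : 1 ≤ a) (hab : a ≤ b) {B : ℝ}
    (hB : ∀ k, a ≤ k → k ≤ b + 1 → ‖∑ i ∈ Finset.range k, g i‖ ≤ B) :
    ‖∑ n ∈ Finset.Icc a b, g n / n‖ ≤ 3 * B / a := by
  have hB0 : 0 ≤ B := le_trans (norm_nonneg _) (hB a le_rfl (by omega))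
  have ha0 : (0 : ℝ) < a := by exact_mod_cast ha
  -- Abel summation on `Ioc (a-1) b`
  have hIcc : Finset.Icc a b = Finset.Ioc (a - 1) b := by
    ext n; simp only [Finset.mem_Icc, Finset.mem_Ioc]; omega
  set f : ℕ → ℂ := fun n => 1 / (n : ℂ) with hf
  have hsum : ∑ n ∈ Finset.Icc a b, g n / n = ∑ n ∈ Finset.Ioc (a - 1) b, f n • g n := by
    rw [hIcc]; refine Finset.sum_congr rfl fun n _ => ?_; simp [hf, div_eq_inv_mul]
  rw [hsum, Finset.sum_Ioc_by_parts f g (by omega : a - 1 < b)]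
  have ha1 : a - 1 + 1 = a := by omega
  rw [ha1]
  -- bounds on the three pieces
  have hf_norm : ∀ n : ℕ, 1 ≤ n → ‖f n‖ = 1 / n := fun n hn => by
    simp [hf]
  have h1 : ‖f b • ∑ i ∈ Finset.range (b + 1), g i‖ ≤ B / a := by
    rw [norm_smul, hf_norm b (by omega)]
    calc 1 / (b : ℝ) * ‖∑ i ∈ Finset.range (b + 1), g i‖ ≤ 1 / (a : ℝ) * B := by
          refine mul_le_mul ?_ (hB _ (by omega) le_rfl) (norm_nonneg _) (by positivity)
          exact one_div_le_one_div_of_le ha0 (by exact_mod_cast hab)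
      _ = B / a := by ring
  have h2 : ‖f a • ∑ i ∈ Finset.range a, g i‖ ≤ B / a := by
    rw [norm_smul, hf_norm a ha]
    calc 1 / (a : ℝ) * ‖∑ i ∈ Finset.range a, g i‖ ≤ 1 / (a : ℝ) * B :=
          mul_le_mul_of_nonneg_left (hB _ le_rfl (by omega)) (by positivity)
      _ = B / a := by ring
  have h3 : ‖∑ i ∈ Finset.Ioc (a - 1) (b - 1), (f (i + 1) - f i) • ∑ j ∈ Finset.range (i + 1), g j‖ ≤ B / a := by
    calc ‖∑ i ∈ Finset.Ioc (a - 1) (b - 1), (f (i + 1) - f i) • ∑ j ∈ Finset.range (i + 1), g j‖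
        ≤ ∑ i ∈ Finset.Ioc (a - 1) (b - 1), ‖(f (i + 1) - f i) • ∑ j ∈ Finset.range (i + 1), g j‖ :=
          norm_sum_le _ _
      _ ≤ ∑ i ∈ Finset.Ioc (a - 1) (b - 1), (1 / (i : ℝ) - 1 / (i + 1 : ℝ)) * B := by
          refine Finset.sum_le_sum fun i hi => ?_
          have hi1 : 1 ≤ i := by have := (Finset.mem_Ioc.1 hi).1; omega
          have hi0 : (0 : ℝ) < i := by exact_mod_cast hi1
          rw [norm_smul]
          refine mul_le_mul ?_ (hB _ (by have := (Finset.mem_Ioc.1 hi).1; omega)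
            (by have := (Finset.mem_Ioc.1 hi).2; omega)) (norm_nonneg _) ?_
          · have e : f (i + 1) - f i = -(((1 : ℝ) / i - 1 / (i + 1) : ℝ) : ℂ) := by
              simp only [hf]; push_cast; field_simp; ring
            rw [e, norm_neg, Complex.norm_real, Real.norm_eq_abs, abs_of_nonneg]
            rw [sub_nonneg]; exact one_div_le_one_div_of_le hi0 (by linarith)
          · rw [sub_nonneg]; exact one_div_le_one_div_of_le hi0 (by linarith)
      _ = B * ∑ i ∈ Finset.Ioc (a - 1) (b - 1), (1 / (i : ℝ) - 1 / (i + 1 : ℝ)) := by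
          rw [Finset.mul_sum]; refine Finset.sum_congr rfl fun i _ => ?_; ring
      _ = B * (1 / (a : ℝ) - 1 / (b : ℝ)) := by
          congr 1
          have htel : ∀ m : ℕ, ∑ i ∈ Finset.Ioc (a - 1) (a - 1 + m), (1 / (i : ℝ) - 1 / (i + 1 : ℝ))
              = 1 / (a : ℝ) - 1 / ((a - 1 + m : ℕ) + 1 : ℝ) := by
            intro m
            induction m with
            | zero =>
              simp
              have : ((a - 1 : ℕ) : ℝ) + 1 = a := by rw [Nat.cast_sub ha]; push_cast; ring
              rw [this]; simp
            | succ m ih =>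
              rw [show a - 1 + (m + 1) = (a - 1 + m) + 1 by omega, Finset.sum_Ioc_succ_top (by omega), ih]
              push_cast; ring
          have hb : b - 1 = a - 1 + (b - a) := by omega
          rw [hb, htel (b - a)]
          have : ((a - 1 + (b - a) : ℕ) : ℝ) + 1 = b := by
            rw [show a - 1 + (b - a) = b - 1 by omega, Nat.cast_sub (by omega)]; push_cast; ring
          rw [this]
      _ ≤ B / a := by
          have : 0 ≤ 1 / (b : ℝ) := by positivity
          have : B * (1 / (a : ℝ) - 1 / (b : ℝ)) = B / a - B * (1 / (b : ℝ)) := by ring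
          rw [this]; nlinarith
  calc ‖f b • ∑ i ∈ Finset.range (b + 1), g i - f a • ∑ i ∈ Finset.range a, g i -
        ∑ i ∈ Finset.Ioc (a - 1) (b - 1), (f (i + 1) - f i) • ∑ j ∈ Finset.range (i + 1), g j‖
      ≤ ‖f b • ∑ i ∈ Finset.range (b + 1), g i‖ + ‖f a • ∑ i ∈ Finset.range a, g i‖ +
        ‖∑ i ∈ Finset.Ioc (a - 1) (b - 1), (f (i + 1) - f i) • ∑ j ∈ Finset.range (i + 1), g j‖ := by
          exact (norm_sub_le _ _).trans (by gcongr; exact norm_sub_le _ _)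
    _ ≤ B / a + B / a + B / a := by linarith
    _ = 3 * B / a := by ring

/-! ### The sifted twist `G(n) = f(n) 1_{(n, 𝒫_S) = 1} n^{-it}` and its pretentious distance -/

/-- The indicator of the integers free of primes from `S` (with value `0` at `0`), as an arithmetic
function. [folklore] -/
def sieveInd (S : Finset ℕ) : ArithmeticFunction ℂ :=
  ⟨fun n => if n = 0 then 0 else if ∃ p ∈ S, p ∣ n then 0 else 1, by simp⟩

/-- Values of `sieveInd`. [folklore] -/
theorem sieveInd_apply (S : Finset ℕ) (n : ℕ) :
    sieveInd S n = if n = 0 then 0 else if ∃ p ∈ S, p ∣ n then 0 else 1 := rfl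

/-- `‖1_S(n)‖ ≤ 1`. [folklore] -/
theorem norm_sieveInd_le (S : Finset ℕ) (n : ℕ) : ‖sieveInd S n‖ ≤ 1 := by
  rw [sieveInd_apply]; split_ifs <;> simp

/-- `sieveInd S` is multiplicative when `S` consists of primes. [folklore] -/
theorem isMultiplicative_sieveInd {S : Finset ℕ} (hS : ∀ p ∈ S, p.Prime) :
    (sieveInd S).IsMultiplicative := by
  refine ⟨?_, ?_⟩
  · rw [sieveInd_apply, if_neg one_ne_zero, if_neg]
    rintro ⟨p, hp, h⟩
    exact (hS p hp).one_lt.ne' (Nat.dvd_one.1 h)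
  intro m n hmn
  rcases eq_or_ne m 0 with rfl | hm
  · simp [sieveInd_apply]
  rcases eq_or_ne n 0 with rfl | hn
  · simp [sieveInd_apply]
  simp only [sieveInd_apply, hm, hn, mul_eq_zero, or_self, if_false]
  by_cases h : ∃ p ∈ S, p ∣ m * n
  · rw [if_pos h]
    obtain ⟨p, hp, hdvd⟩ := h
    rcases (hS p hp).dvd_mul.1 hdvd with h1 | h1
    · rw [if_pos (show ∃ p ∈ S, p ∣ m from ⟨p, hp, h1⟩), zero_mul]
    · rw [if_pos (show ∃ p ∈ S, p ∣ n from ⟨p, hp, h1⟩), mul_zero]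
  · rw [if_neg h]
    push Not at h
    rw [if_neg (by push Not; exact fun p hp h1 => h p hp (h1.mul_right n)),
      if_neg (by push Not; exact fun p hp h1 => h p hp (h1.mul_left m)), one_mul]

/-- At a prime `q`: `1_S(q) = 0` if `q ∈ S`, `= 1` otherwise (for `S` a set of primes). [folklore] -/
theorem sieveInd_prime {S : Finset ℕ} (hS : ∀ p ∈ S, p.Prime) {q : ℕ} (hq : q.Prime) :
    sieveInd S q = if q ∈ S then 0 else 1 := by
  rw [sieveInd_apply, if_neg hq.ne_zero]
  by_cases h : q ∈ S
  · rw [if_pos ⟨q, h, dvd_rfl⟩, if_pos h]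
  · rw [if_neg h, if_neg]
    rintro ⟨p, hp, hpq⟩
    have : p = q := (Nat.prime_dvd_prime_iff_eq (hS p hp) hq).1 hpq
    exact h (this ▸ hp)

/-- The sifted twist `G = (f · 1_S) n^{-it}` of a real arithmetic function. [folklore] -/
def siftedTwist (f : ArithmeticFunction ℝ) (S : Finset ℕ) (t : ℝ) : ArithmeticFunction ℂ :=
  twistAF ((toComplexAF f).pmul (sieveInd S)) t

/-- Values of the sifted twist. [folklore] -/
theorem siftedTwist_apply (f : ArithmeticFunction ℝ) (S : Finset ℕ) (t : ℝ) (n : ℕ) :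
    siftedTwist f S t n = (f n : ℂ) * sieveInd S n * (n : ℂ) ^ (-(t * I)) := by
  simp [siftedTwist, ArithmeticFunction.pmul_apply]

/-- The sifted twist is multiplicative and `1`-bounded. [folklore] -/
theorem isMultiplicative_siftedTwist {f : ArithmeticFunction ℝ} (hf : f.IsMultiplicative)
    {S : Finset ℕ} (hS : ∀ p ∈ S, p.Prime) (t : ℝ) : (siftedTwist f S t).IsMultiplicative :=
  isMultiplicative_twistAF ((isMultiplicative_toComplexAF hf).pmul (isMultiplicative_sieveInd hS)) t

/-- `‖G(n)‖ ≤ 1`. [folklore] -/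
theorem norm_siftedTwist_le {f : ArithmeticFunction ℝ} (hf : ∀ n, |f n| ≤ 1) (S : Finset ℕ) (t : ℝ)
    (n : ℕ) : ‖siftedTwist f S t n‖ ≤ 1 := by
  refine norm_twistAF_le (fun m => ?_) t n
  rw [ArithmeticFunction.pmul_apply, norm_mul]
  calc ‖toComplexAF f m‖ * ‖sieveInd S m‖ ≤ 1 * 1 :=
        mul_le_mul (norm_toComplexAF_le hf m) (norm_sieveInd_le S m) (norm_nonneg _) zero_le_one
    _ = 1 := one_mul 1

/-- **The distance of the sifted twist**: for `S` a set of primes, real `|f| ≤ 1`, and all `y, t, u`,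
`𝔻(G, n^{iu}; y)² ≥ ¼ 𝔻(1, n^{2i(t+u)}; y)² + ½ ∑_{p ≤ y, p ∈ S} 1/p`
(termwise: for `p ∈ S` the summand is `1/p ≥ ¼ · 2/p · … `; for `p ∉ S` it is `(1 − f(p) cos((t+u) log p))/p
≥ ¼ (1 − cos(2(t+u) log p))/p`, `PretentiousFord.one_sub_re_sq_le`).  The second term is the gain from
sifting that compensates the sum over the `S`-composed cofactor in Lemma 3. [folklore] -/
theorem Msum_siftedTwist_ge {f : ArithmeticFunction ℝ} (hf : ∀ n, |f n| ≤ 1) {S : Finset ℕ}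
    (hS : ∀ p ∈ S, p.Prime) (y t u : ℝ) :
    (1 / 4) * pretentiousDistSq 1 (fun n : ℕ => (n : ℂ) ^ (((2 * (t + u) : ℝ) : ℂ) * I)) y
        + (1 / 2) * ∑ p ∈ (Nat.primesLE ⌊y⌋₊).filter (· ∈ S), (1 : ℝ) / p
      ≤ Msum (siftedTwist f S t) y u := by
  classical
  rw [Msum, pretentiousDistSq, Finset.mul_sum, Finset.mul_sum, Finset.sum_filter, ← Finset.sum_add_distrib]
  -- `primesBelow (⌊y⌋₊ + 1) = primesLE ⌊y⌋₊`
  show ∑ p ∈ Nat.primesLE ⌊y⌋₊, _ ≤ ∑ p ∈ Nat.primesLE ⌊y⌋₊, _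
  refine Finset.sum_le_sum fun p hp => ?_
  have hpP := (Nat.mem_primesLE.1 hp).2
  have hp0 : 0 < p := hpP.pos
  have hp0' : (p : ℂ) ≠ 0 := by exact_mod_cast hp0.ne'
  have hpR : (0 : ℝ) < p := by exact_mod_cast hp0
  set w : ℂ := (p : ℂ) ^ (((t + u : ℝ) : ℂ) * I) with hw
  have hwn : ‖w‖ = 1 := by rw [hw, Complex.norm_natCast_cpow_of_pos hp0]; simp
  have hsq : (p : ℂ) ^ (((2 * (t + u) : ℝ) : ℂ) * I) = w ^ 2 := by
    rw [hw, sq, ← Complex.cpow_add _ _ hp0']; push_cast; ring_nf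
  have hconj : starRingEnd ℂ w = (p : ℂ) ^ (-(((t + u : ℝ) : ℂ) * I)) := by
    rw [hw, ← natCast_cpow_conj]; congr 1
    simp [Complex.conj_ofReal, Complex.conj_I]
  -- the `G`-summand
  have hG : (siftedTwist f S t p * (p : ℂ) ^ (-(u * I))) =
      (if p ∈ S then 0 else (f p : ℂ) * starRingEnd ℂ w) := by
    rw [siftedTwist_apply, sieveInd_prime hS hpP]
    split_ifs with h
    · simp
    · rw [hconj, mul_one, mul_assoc, ← Complex.cpow_add _ _ hp0']
      congr 2; push_cast; ring
  rw [hsq, Pi.one_apply, one_mul, hG]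
  have key := Literature.NumberTheory.LFunctions.PretentiousFord.one_sub_re_sq_le hwn (hf p)
  have hre2 : (starRingEnd ℂ (w ^ 2)).re ≥ -1 := by
    have : ‖starRingEnd ℂ (w ^ 2)‖ = 1 := by rw [Complex.norm_conj, norm_pow, hwn, one_pow]
    have := Complex.abs_re_le_norm (starRingEnd ℂ (w ^ 2))
    rw [‹‖(starRingEnd ℂ) (w ^ 2)‖ = 1›] at this
    linarith [abs_le.1 this |>.1]
  split_ifs with hmem
  · -- `p ∈ S`: summand `1/p`
    simp only [Complex.zero_re, sub_zero]
    have e : 1 / 4 * ((1 - (starRingEnd ℂ (w ^ 2)).re) / (p : ℝ)) + 1 / 2 * (1 / (p : ℝ))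
        = (1 / 4 * (1 - (starRingEnd ℂ (w ^ 2)).re) + 1 / 2) / p := by ring
    rw [e, div_le_div_iff_of_pos_right hpR]
    linarith
  · simp only [add_zero]
    rw [mul_div_assoc', div_le_div_iff_of_pos_right hpR]
    linarith

/-! ### The short logarithmic sum `∑_{a ≤ n ≤ b} g(n)/n` -/

/-- `Msum` is monotone in the length (more nonnegative summands). [folklore] -/
theorem Msum_mono {g : ℕ → ℂ} (hg : ∀ n, ‖g n‖ ≤ 1) {x x' : ℝ} (hxx' : x ≤ x') (y : ℝ) :
    Msum g x y ≤ Msum g x' y := by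
  rw [Msum_eq_pretentiousDistSq, Msum_eq_pretentiousDistSq]
  refine pretentiousDistSq_mono hg (fun n => ?_) hxx'
  rcases Nat.eq_zero_or_pos n with rfl | hn
  · rcases eq_or_ne ((y : ℂ) * I) 0 with h0 | h0
    · simp [h0]
    · simp [Complex.zero_cpow h0]
  · rw [Complex.norm_natCast_cpow_of_pos hn]; simp

/-- **MR's Lemma 1 for a logarithmically weighted short sum**: with `C` from `halasz_of_GS`, for
multiplicative `|g| ≤ 1`, naturals `4 ≤ a ≤ b`, `T ≥ 1` and `M₀ ≤ 𝔻(g, n^{iy}; a − 1)²` for all `|y| ≤ 2T`,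
`‖∑_{a ≤ n ≤ b} g(n)/n‖ ≤ (3b/a) (C e^{-(39/40) M₀} + C (1/T + log log b / log (a−1)))`
(Halász at each `x = k − 1 ∈ [a − 1, b]`, monotonicity of the distance in `x`, and partial summation).
[cite: MatomakiRadziwillAnnals2016, Lemma 1] -/
theorem norm_sum_Icc_div_le {C : ℝ} (hC0 : 0 ≤ C)
    (hH : ∀ g : ArithmeticFunction ℂ, g.IsMultiplicative → (∀ n, ‖g n‖ ≤ 1) →
      ∀ x T M₀ : ℝ, 3 ≤ x → 1 ≤ T → (∀ y : ℝ, |y| ≤ 2 * T → M₀ ≤ Msum g x y) →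
        ‖∑ n ∈ Icc 1 ⌊x⌋₊, g n‖ ≤
          x * (C * Real.exp (-(39 / 40) * M₀) + C * (1 / T + Real.log (Real.log x) / Real.log x)))
    {g : ArithmeticFunction ℂ} (hg : g.IsMultiplicative) (hg1 : ∀ n, ‖g n‖ ≤ 1)
    {a b : ℕ} (ha : 4 ≤ a) (hab : a ≤ b) {T M₀ : ℝ} (hT : 1 ≤ T)
    (hM : ∀ y : ℝ, |y| ≤ 2 * T → M₀ ≤ Msum g ((a - 1 : ℕ) : ℝ) y) :
    ‖∑ n ∈ Finset.Icc a b, g n / n‖ ≤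
      3 * b / a * (C * Real.exp (-(39 / 40) * M₀) + C * (1 / T + Real.log (Real.log b) / Real.log ((a - 1 : ℕ) : ℝ))) := by
  have ha1 : (3 : ℝ) ≤ ((a - 1 : ℕ) : ℝ) := by exact_mod_cast (by omega : 3 ≤ a - 1)
  have hb : ((a - 1 : ℕ) : ℝ) ≤ b := by exact_mod_cast (by omega : a - 1 ≤ b)
  have hloga : 1 < Real.log ((a - 1 : ℕ) : ℝ) := by
    rw [← Real.log_exp 1]
    refine Real.log_lt_log (Real.exp_pos 1) (lt_of_lt_of_le ?_ ha1)
    have := Real.exp_one_lt_d9; norm_num at this ⊢; linarith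
  set Bnd : ℝ := C * Real.exp (-(39 / 40) * M₀) +
    C * (1 / T + Real.log (Real.log b) / Real.log ((a - 1 : ℕ) : ℝ)) with hBnd
  have hBnd0 : 0 ≤ Bnd := by
    have : 0 ≤ Real.log (Real.log b) := Real.log_nonneg (by linarith [Real.log_le_log (by linarith) hb])
    positivity
  -- the partial sums
  have hpart : ∀ k, a ≤ k → k ≤ b + 1 → ‖∑ i ∈ Finset.range k, g i‖ ≤ b * Bnd := by
    intro k hk hkb
    have hk1 : (3 : ℝ) ≤ ((k - 1 : ℕ) : ℝ) := by exact_mod_cast (by omega : 3 ≤ k - 1)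
    have hkb' : ((k - 1 : ℕ) : ℝ) ≤ b := by exact_mod_cast (by omega : k - 1 ≤ b)
    have hka : ((a - 1 : ℕ) : ℝ) ≤ ((k - 1 : ℕ) : ℝ) := by exact_mod_cast (by omega : a - 1 ≤ k - 1)
    -- `∑_{i < k} g i = ∑_{i ∈ Icc 1 (k-1)} g i`
    have hrange : ∑ i ∈ Finset.range k, g i = ∑ i ∈ Icc 1 ⌊((k - 1 : ℕ) : ℝ)⌋₊, g i := by
      rw [Nat.floor_natCast, Finset.range_eq_Ico]
      have : Finset.Ico 0 k = insert 0 (Icc 1 (k - 1)) := by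
        ext i; simp only [Finset.mem_Ico, Finset.mem_insert, Finset.mem_Icc]; omega
      rw [this, Finset.sum_insert (by simp), ArithmeticFunction.map_zero, zero_add]
    rw [hrange]
    have hMk : ∀ y : ℝ, |y| ≤ 2 * T → M₀ ≤ Msum g ((k - 1 : ℕ) : ℝ) y := fun y hy =>
      (hM y hy).trans (Msum_mono hg1 hka y)
    have h := hH g hg hg1 _ T M₀ hk1 hT hMk
    refine h.trans ?_
    have hll : Real.log (Real.log ((k - 1 : ℕ) : ℝ)) / Real.log ((k - 1 : ℕ) : ℝ) ≤
        Real.log (Real.log b) / Real.log ((a - 1 : ℕ) : ℝ) := by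
      have hlk : Real.log ((a - 1 : ℕ) : ℝ) ≤ Real.log ((k - 1 : ℕ) : ℝ) := Real.log_le_log (by linarith) hka
      have hlb : Real.log ((k - 1 : ℕ) : ℝ) ≤ Real.log b := Real.log_le_log (by linarith) hkb'
      have h0 : 0 ≤ Real.log (Real.log ((k - 1 : ℕ) : ℝ)) := Real.log_nonneg (by linarith)
      calc Real.log (Real.log ((k - 1 : ℕ) : ℝ)) / Real.log ((k - 1 : ℕ) : ℝ)
          ≤ Real.log (Real.log b) / Real.log ((k - 1 : ℕ) : ℝ) :=
            div_le_div_of_nonneg_right (Real.log_le_log (by linarith) hlb) (by linarith)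
        _ ≤ Real.log (Real.log b) / Real.log ((a - 1 : ℕ) : ℝ) :=
            div_le_div_of_nonneg_left (h0.trans (Real.log_le_log (by linarith) hlb)) (by linarith) hlk
    have hBk : C * Real.exp (-(39 / 40) * M₀) + C * (1 / T + Real.log (Real.log ((k - 1 : ℕ) : ℝ)) / Real.log ((k - 1 : ℕ) : ℝ)) ≤ Bnd := by
      rw [hBnd]; gcongr
    calc ((k - 1 : ℕ) : ℝ) * (C * Real.exp (-(39 / 40) * M₀) +
          C * (1 / T + Real.log (Real.log ((k - 1 : ℕ) : ℝ)) / Real.log ((k - 1 : ℕ) : ℝ)))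
        ≤ ((k - 1 : ℕ) : ℝ) * Bnd := mul_le_mul_of_nonneg_left hBk (by linarith)
      _ ≤ b * Bnd := mul_le_mul_of_nonneg_right hkb' hBnd0
  have h := norm_sum_div_le_of_partial (by omega : 1 ≤ a) hab hpart
  calc ‖∑ n ∈ Finset.Icc a b, g n / n‖ ≤ 3 * (b * Bnd) / a := h
    _ = 3 * b / a * Bnd := by ring

end MatomakiRadziwillL3

end Literature.NumberTheory.Sieve
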